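import Literature.AlgebraicGeometry.AbelianSchemes.RoofBaseChangeAlongBaseIso                -- ★ p849519 (mine) points transfers §1 + `roof_baseChange_of_isIso`
import Literature.AlgebraicGeometry.AbelianSchemes.PointsTransferRestrictPtBaseChangeComp    -- ★ p849541 (LA4-p03) the `hpt` junction of the re-index step
import Literature.AlgebraicGeometry.AbelianSchemes.TupleIsoPointCriteria                    -- ★ `exists_iso_of_tupleRel_id`; re-exports ★ `tupleRel_baseChangeCompGrpIso_inv`
import HarnessLib

/-!
# The isogeny ROOF of a PEL FAMILY read at two `Ω`-points `ℓ₁, ℓ₂` moves to the roof read at `x ≫ ℓ₁, x ≫ ℓ₂` for an ISOMORPHISM `x : Spec Ω′ ≅ Spec Ω`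

Topic `AlgebraicGeometry/AbelianSchemes`; namespace `Literature.AlgebraicGeometry.AbelianSchemes.AbelianSchemeOver`.  THEOREMS ONLY (no definition,
no named fact, no instance, no notation, no `sorry`).  Cell `hodgecm-mathlib` (D-0151), P6 «MOD programme» (crux hLiu418 = stmt-HodgeConjecture-24832,
`--supports`, count-neutral), line «L4», X-LEAF `Lines/F0_P6a_EExports.lean` (A-p01 (g28)) socket `stub_ECtoΩ` «transport of the E-readings `RoofE` ∕
`HeckeRoofsE` from `ℂ`-points to `F̄_w`-points along a ring isomorphism `σ : F̄_w ≃ ℂ` over `ι₁`» (LA4-plan (g0) DEAL #20′ (ii), ROOF half — the twin of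
LA4-p03 (g2)'s ★ `SerreCoverKerAlongPointBaseChange.coverKer_readAt_comp` for the COVER half).  THE ONE-CALL FORM, in the BODY CURRENCY of the E-readings
(`schEOf = 𝒜.baseChange ℓ`, `(actEOf a).hom.hom.hom = baseChangeHom (ρ.i a) ℓ` by `rfl` (★ `fibreHom_hom_hom_hom`), `dualEOf = D.baseChange ℓ`,
`polEOf = pol.baseChange ℓ`, `lvlPtEOf a = 𝒜.restrictPt ℓ (lvl.section_ a)`, `IsIdealTorsionE … 𝔞 P = ∀ a ∈ 𝔞, ι(a)_ℓ P = 1`, `ℓ = ℓ_e y`): the five-clause ROOF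
SHAPE `𝒜_{ℓ₁} —q→ B ←c— 𝒜_{ℓ₂}` ((r1) `Ker q(Ω) = K`, (r2) `Ker c(Ω) = 𝒜_{ℓ₂}[𝔞](Ω)`, `c` onto, (r3) `q^*λ_B = p·λ_{ℓ₁}`, `c^*λ_B = p·λ_{ℓ₂}`, (r4) `ι`-equivariance
through a common endomorphism of `B`, (r5) `q(σᵃ(ℓ₁)) = c(σᵃ(ℓ₂))`) of ONE PEL family `(𝒜, ι, (Â, 𝒫), λ, lvl)` over `Y` read at `ℓ₁, ℓ₂ : Spec Ω → Y`
yields the same shape read at `x ≫ ℓ₁, x ≫ ℓ₂ : Spec Ω′ → Y`, the kernel subgroup `K ≤ 𝒜_{ℓ₁}(Ω)` replaced by any `K′ ≤ 𝒜_{x ≫ ℓ₁}(Ω′)` corresponding to it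
under THE transfer of points `Φ : 𝒜_{ℓ₁}(Ω) → 𝒜_{x ≫ ℓ₁}(Ω′)` (`(Φ P) ≫ pr_𝒜 = x ≫ P ≫ pr_𝒜`; §1: it exists as a MULTIPLICATIVE EQUIVALENCE natural in `ι` and
detecting ideal torsion, so `K′ := Φ(K)` — or, for `K` cut out by a torsion condition, the same condition at `x ≫ ℓ₁` — is available to the consumer).
Unlike the cover half, `x` MUST be an isomorphism: (r1)(r2) quantify over ALL `Ω′`-points.  So `stub_ECtoΩ` (roof rows) = THIS head at
`x := Spec σ⁻¹ : Spec F̄_w ⟶ Spec ℂ` after the two-field sheet law `(ℓ_{σ∘e′}(σ_* y)).left = Spec σ ≫ (ℓ_{e′} y).left` (★ p849545), i.e.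
`x ≫ ℓ_{σ∘e′}(σ_* y) = ℓ_{e′} y`.  HC_CM is proved only modulo the 2 remaining named inputs (hLiu418 24832, h413 24833) until rung 0 closes; nothing here is about HC.

THE MATHEMATICS ([GortzWedhorn2020] (4.7), Prop. 4.16; [MumfordFogartyKirwan1994] Ch. 6 §1 Cor. 6.4∕6.8, Ch. 7 §2 Def. 7.2–7.3; [MumfordAV1970] §15 Thm. 1;
[Milne2005ShimuraVarieties] §14: every datum of a polarised abelian variety with endomorphisms and level points is compatible with an isomorphism of the
field of definition of the point).  Three ★ steps, as in the cover twin: (1) base change of the shape along `x` for the tuples `𝒜 ×_Y ℓᵢ` over `Spec Ω`, the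
`Ω`-point data moved by transfers (★ `roof_baseChange_of_isIso`, ★ `exists_pointsTransfer`; `x` iso); (2) `(𝒜 ×_Y ℓᵢ) ×_Ω Spec Ω′ ≅ 𝒜 ×_Y (x ≫ ℓᵢ)` IS a
six-clause relation along `𝟙 (Spec Ω′)` (★ `tupleRel_baseChangeCompGrpIso_inv`), hence an exact isomorphism of group schemes (★ `exists_iso_of_tupleRel_id`);
(3) transport of the shape along these (★ `roof_transport_along_iso`), the point hypothesis being ★ `map_pointsTransfer_restrictPt_of_left_eq_baseChangeCompGrpIso_inv`
and the kernel subgroups threaded through `K ↦ Φ⁻¹…`.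

* §1 `points_baseChange_ext` (an `Ω′`-point of `𝒜 ×_Y m` is determined by its projection to `𝒜`), **`exists_pointsAlong_mulEquiv`** (THE transfer
  `Φ : 𝒜_ℓ(Ω) ≃* 𝒜_{x ≫ ℓ}(Ω′)` exists, `x` iso), `pointsAlong_map` (naturality in endomorphisms `u` of `𝒜`: `Φ (u_ℓ P) = u_{x ≫ ℓ} (Φ P)`),
  `pointsAlong_forall_map_eq_one_iff` (ideal torsion is detected), `pointsAlong_restrictPt` (`Φ (σ(ℓ)) = σ(x ≫ ℓ)`);
* §2 **`roof_readAt_comp`** — THE HEAD.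
* §3 (ED. 2) SUBGROUP DATA ALONG THE TRANSFER — the remaining clauses of the Hecke-roofs reading `HeckeRoofsE` (lines `H_β`, their count∕torsion∕stability,
  the exhaustion clause, the kernel-membership clauses) move along `Φ` by `K ↦ Φ(K)`: `along_mem_map_iff` (the `hK` input of §2 for `K′ := Φ(K)`),
  `along_lines` (card ∕ `𝔞`-torsion ∕ `ι`-stability of `Φ(H)`), `along_onto` (every subgroup of `𝒜_{x ≫ ℓ}(Ω′)` with the three properties is a `Φ(H_β)` if
  every such subgroup of `𝒜_ℓ(Ω)` is an `H_β`), `along_mem_iff_mem_and_torsion`, `along_mem_iff_torsion` (membership cut out by a subgroup and∕or the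
  `𝔞`-torsion condition) — pure group theory over §1 ([MumfordFogartyKirwan1994] Ch. 6 §1 Cor. 6.4: points and endomorphisms commute with base change).

## References
* [GortzWedhorn2020] U. Görtz, T. Wedhorn, *Algebraic Geometry I*, 2nd ed. (2020), Section (4.7) (pp. 107–108), Prop. 4.16 (p. 101).
* [MumfordFogartyKirwan1994] D. Mumford, J. Fogarty, F. Kirwan, *Geometric Invariant Theory*, 3rd ed. (1994), Ch. 6 §1 Cor. 6.4 (p. 117), Cor. 6.8 (p. 118); Ch. 7 §2 Def. 7.2 (p. 129), Def. 7.3 (p. 130).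
* [MumfordAV1970] D. Mumford, *Abelian Varieties* (1970), §15 Thm. 1 (p. 143); §23 Thm. 2 (p. 231).
* [Milne2005ShimuraVarieties] J. S. Milne, *Introduction to Shimura varieties* (2005), §14 pp. 124–125.
-/

set_option autoImplicit false

noncomputable section

-- Mathlib's `Over`/pull-back API is stated across semireducible wrappers (as in the ★ `AbelianSchemes/*` files).
set_option backward.isDefEq.respectTransparency false

universe u

open CategoryTheory CategoryTheory.Limits AlgebraicGeometry MonoidalCategory
open scoped MonObj Obj

namespace Literature.AlgebraicGeometry.AbelianSchemes

namespace AbelianSchemeOver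

open Literature.AlgebraicGeometry.Motives (AlgPoints specOver)

/-! ### §1 THE transfer of fibre points `Φ : 𝒜_ℓ(Ω) → 𝒜_{x ≫ ℓ}(Ω′)` -/

section Along

variable {Y : Scheme.{u}} (𝒜 : AbelianSchemeOver Y) {Ω Ω' : Type u} [Field Ω] [Field Ω']
  (ℓ : Spec (.of Ω) ⟶ Y) (x : Spec (.of Ω') ⟶ Spec (.of Ω))

/-- **An `Ω′`-point of `𝒜 ×_Y m` is determined by its projection to `𝒜`** (its second coordinate is the structure map of `Spec Ω′`, i.e. `𝟙`).
[cite: GortzWedhorn2020, Section (4.7) (pp. 107–108)] -/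
theorem points_baseChange_ext (m : Spec (.of Ω') ⟶ Y) (Q Q' : (𝒜.baseChange m).toAffine.toAbelianVariety.Points Ω')
    (h : Q.left ≫ pullback.fst 𝒜.X.hom m = Q'.left ≫ pullback.fst 𝒜.X.hom m) : Q = Q' := by
  have hQ : Q.left ≫ pullback.snd 𝒜.X.hom m = 𝟙 _ := (Over.w Q).trans (specOver_self_hom (K := Ω'))
  have hQ' : Q'.left ≫ pullback.snd 𝒜.X.hom m = 𝟙 _ := (Over.w Q').trans (specOver_self_hom (K := Ω'))
  apply Over.OverMorphism.ext
  apply pullback.hom_ext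
  · exact h
  · rw [hQ, hQ']

variable [IsIso x]

/-- **THE TRANSFER `Φ : 𝒜_ℓ(Ω) ≃* 𝒜_{x ≫ ℓ}(Ω′)` EXISTS** for `x` an isomorphism: a multiplicative equivalence with `(Φ P) ≫ pr_𝒜 = x ≫ P ≫ pr_𝒜` — the transfer
of points along `x` (★ `exists_pointsTransfer`, multiplicative and bijective) followed by the exact comparison `(𝒜 ×_Y ℓ) ×_Ω Spec Ω′ ≅ 𝒜 ×_Y (x ≫ ℓ)`
(★ `tupleRel_baseChangeCompGrpIso_inv` is along `𝟙`, its underlying map has first projection ★ `baseChangeCompGrpIso_inv_left_fst`).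
[cite: GortzWedhorn2020, Section (4.7) (pp. 107–108) and Prop. 4.16 (p. 101)] -/
theorem exists_pointsAlong_mulEquiv :
    ∃ Φ : (𝒜.baseChange ℓ).toAffine.toAbelianVariety.Points Ω ≃* (𝒜.baseChange (x ≫ ℓ)).toAffine.toAbelianVariety.Points Ω',
      ∀ P, (Φ P).left ≫ pullback.fst 𝒜.X.hom (x ≫ ℓ) = x ≫ P.left ≫ pullback.fst 𝒜.X.hom ℓ := by
  obtain ⟨ε, hε⟩ := exists_pointsTransfer x (𝒜.baseChange ℓ)
  -- the transfer as a multiplicative equivalence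
  let εh : (𝒜.baseChange ℓ).toAffine.toAbelianVariety.Points Ω →* ((𝒜.baseChange ℓ).baseChange x).toAffine.toAbelianVariety.Points Ω' :=
    { toFun := ε, map_one' := pointsTransfer_one hε, map_mul' := pointsTransfer_mul hε }
  let εe := MulEquiv.ofBijective εh ⟨pointsTransfer_injective hε, pointsTransfer_surjective_of_isIso hε⟩
  -- the comparison isomorphism, as a group isomorphism on points
  haveI := 𝒜.isIso_baseChangeCompGrpIso_inv_hom_hom ℓ x
  haveI : IsMonHom (asIso (𝒜.baseChangeCompGrpIso ℓ x).inv.hom.hom).hom := by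
    change IsMonHom (𝒜.baseChangeCompGrpIso ℓ x).inv.hom.hom
    infer_instance
  obtain ⟨φ, hφ, -⟩ := exists_mulEquiv_points_of_iso (asIso (𝒜.baseChangeCompGrpIso ℓ x).inv.hom.hom)
  refine ⟨εe.trans φ, fun P => ?_⟩
  change (φ (ε P)).left ≫ _ = _
  rw [hφ, AlgPoints.map_apply, Over.comp_left, Category.assoc]
  change (ε P).left ≫ (𝒜.baseChangeCompGrpIso ℓ x).inv.hom.hom.left ≫ pullback.fst 𝒜.X.hom (x ≫ ℓ) = _
  rw [baseChangeCompGrpIso_inv_left_fst, ← Category.assoc]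
  erw [hε P]
  exact Category.assoc _ _ _

variable {𝒜 ℓ x}
  {Φ : (𝒜.baseChange ℓ).toAffine.toAbelianVariety.Points Ω → (𝒜.baseChange (x ≫ ℓ)).toAffine.toAbelianVariety.Points Ω'}
  (hΦ : ∀ P, (Φ P).left ≫ pullback.fst 𝒜.X.hom (x ≫ ℓ) = x ≫ P.left ≫ pullback.fst 𝒜.X.hom ℓ)

include hΦ

omit [IsIso x] in
/-- **FACTORISATION**: any transfer `Φ` (characterised by its projection) is `e ∘ ε` for the transfer of points `ε` along `x` and any `Over`-morphism `e` with the
underlying map of `(baseChangeCompGrpIso ℓ x)⁻¹`. [cite: GortzWedhorn2020, Section (4.7) (pp. 107–108)] -/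
theorem pointsAlong_eq_map_pointsTransfer
    {ε : (𝒜.baseChange ℓ).toAffine.toAbelianVariety.Points Ω → ((𝒜.baseChange ℓ).baseChange x).toAffine.toAbelianVariety.Points Ω'}
    (hε : ∀ P, (ε P).left ≫ pullback.fst (𝒜.baseChange ℓ).X.hom x = x ≫ P.left)
    (f : ((𝒜.baseChange ℓ).baseChange x).X ⟶ (𝒜.baseChange (x ≫ ℓ)).X) (hf : f.left = (𝒜.baseChangeCompGrpIso ℓ x).inv.hom.hom.left)
    (P : (𝒜.baseChange ℓ).toAffine.toAbelianVariety.Points Ω) :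
    Φ P = AlgPoints.map f (ε P) := by
  refine points_baseChange_ext 𝒜 (x ≫ ℓ) _ _ ?_
  rw [hΦ, AlgPoints.map_apply, Over.comp_left, Category.assoc, hf, baseChangeCompGrpIso_inv_left_fst]
  erw [reassoc_of% (hε P)]

omit [IsIso x] in
/-- **NATURALITY IN ENDOMORPHISMS OF THE FAMILY**: `Φ (u_ℓ P) = u_{x ≫ ℓ} (Φ P)` for every `u : 𝒜 → 𝒜` over `Y` (e.g. `u = ι(a)`).
[cite: MumfordFogartyKirwan1994, Ch. 6 §1 Corollary 6.4 (p. 117)] -/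
theorem pointsAlong_map (u : 𝒜.X ⟶ 𝒜.X) (P : (𝒜.baseChange ℓ).toAffine.toAbelianVariety.Points Ω) :
    Φ (AlgPoints.map (baseChangeHom u ℓ) P) =
      (AlgPoints.map (baseChangeHom u (x ≫ ℓ)) (Φ P) : (𝒜.baseChange (x ≫ ℓ)).toAffine.toAbelianVariety.Points Ω') := by
  refine points_baseChange_ext 𝒜 (x ≫ ℓ) _ _ ?_
  rw [hΦ, AlgPoints.map_apply, AlgPoints.map_apply, Over.comp_left, Over.comp_left, Category.assoc, Category.assoc]
  erw [baseChangeHom_left_comp_fst, baseChangeHom_left_comp_fst]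
  rw [← Category.assoc (Φ P).left, hΦ, Category.assoc, Category.assoc]

/-- **IDEAL TORSION IS DETECTED**: `P` is killed by every `ι(a)_ℓ`, `𝔞 a`, iff `Φ P` is killed by every `ι(a)_{x ≫ ℓ}`, `𝔞 a` (`x` iso; the `IsIdealTorsionE` clause
read on both sides). [cite: MumfordFogartyKirwan1994, Ch. 6 §1 Corollary 6.4 (p. 117)] -/
theorem pointsAlong_forall_map_eq_one_iff {O : Type*} (𝔞 : O → Prop) (act : O → (𝒜.X ⟶ 𝒜.X)) (P : (𝒜.baseChange ℓ).toAffine.toAbelianVariety.Points Ω) :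
    (∀ a, 𝔞 a → (AlgPoints.map (baseChangeHom (act a) (x ≫ ℓ)) (Φ P) : (𝒜.baseChange (x ≫ ℓ)).toAffine.toAbelianVariety.Points Ω') = 1) ↔
      ∀ a, 𝔞 a → (AlgPoints.map (baseChangeHom (act a) ℓ) P : (𝒜.baseChange ℓ).toAffine.toAbelianVariety.Points Ω) = 1 := by
  obtain ⟨ε, hε⟩ := exists_pointsTransfer x (𝒜.baseChange ℓ)
  haveI := 𝒜.isIso_baseChangeCompGrpIso_inv_hom_hom ℓ x
  haveI : IsMonHom (asIso (𝒜.baseChangeCompGrpIso ℓ x).inv.hom.hom).hom := by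
    change IsMonHom (𝒜.baseChangeCompGrpIso ℓ x).inv.hom.hom
    infer_instance
  have hfac : Φ P = AlgPoints.map (asIso (𝒜.baseChangeCompGrpIso ℓ x).inv.hom.hom).hom (ε P) :=
    pointsAlong_eq_map_pointsTransfer hΦ hε _ rfl P
  have hact : ∀ a, baseChangeHom (baseChangeHom (act a) ℓ) x ≫ (asIso (𝒜.baseChangeCompGrpIso ℓ x).inv.hom.hom).hom =
      (asIso (𝒜.baseChangeCompGrpIso ℓ x).inv.hom.hom).hom ≫ baseChangeHom (act a) (x ≫ ℓ) := fun a =>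
    baseChangeCompGrpIso_inv_naturality 𝒜 ℓ x (act a)
  rw [hfac, ← forall_map_eq_one_iff_of_iso (asIso (𝒜.baseChangeCompGrpIso ℓ x).inv.hom.hom) 𝔞
    (fun a => baseChangeHom (baseChangeHom (act a) ℓ) x) (fun a => baseChangeHom (act a) (x ≫ ℓ)) hact,
    pointsTransfer_forall_map_eq_one_iff hε 𝔞 (fun a => baseChangeHom (act a) ℓ)]

omit [IsIso x] in
/-- **LEVEL POINTS**: `Φ (σ(ℓ)) = σ(x ≫ ℓ)` for every section `σ` of `𝒜 → Y` (★ p849541 junction). [cite: MumfordFogartyKirwan1994, Ch. 7 §2 Definition 7.1 (p. 129)] -/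
theorem pointsAlong_restrictPt (σ : 𝒜.Sections) : Φ (𝒜.restrictPt ℓ σ) = 𝒜.restrictPt (x ≫ ℓ) σ := by
  obtain ⟨ε, hε⟩ := exists_pointsTransfer x (𝒜.baseChange ℓ)
  rw [pointsAlong_eq_map_pointsTransfer hΦ hε (𝒜.baseChangeCompGrpIso ℓ x).inv.hom.hom rfl]
  exact 𝒜.map_pointsTransfer_restrictPt_of_left_eq_baseChangeCompGrpIso_inv ℓ x hε _ rfl σ

end Along

/-! ### §2 The head: the roof read at `(ℓ₁, ℓ₂)` moves to `(x ≫ ℓ₁, x ≫ ℓ₂)` -/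

section ReadAt

variable {Y : Scheme.{u}} (𝒜 : AbelianSchemeOver Y) {O : Type*} [CommRing O] (ρ : RingAction O 𝒜) (D : 𝒜.DualPair)
  (hD : Nonempty ((Scheme.Modules.pullback D.unitHatSlice).obj D.P ≅ SheafOfModules.unit _))
  (pol : 𝒜.Polarization D) {g n : ℕ} (lvl : 𝒜.LevelStructure g n)
  {Ω Ω' : Type u} [Field Ω] [Field Ω'] (ℓ₁ ℓ₂ : Spec (.of Ω) ⟶ Y) (x : Spec (.of Ω') ⟶ Spec (.of Ω)) [IsIso x]
  (𝔞 : O → Prop) (p : ℕ)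
  (K : Subgroup ((𝒜.baseChange ℓ₁).toAffine.toAbelianVariety.Points Ω))
  (K' : Subgroup ((𝒜.baseChange (x ≫ ℓ₁)).toAffine.toAbelianVariety.Points Ω'))
  {Φ : (𝒜.baseChange ℓ₁).toAffine.toAbelianVariety.Points Ω → (𝒜.baseChange (x ≫ ℓ₁)).toAffine.toAbelianVariety.Points Ω'}
  (hΦ : ∀ P, (Φ P).left ≫ pullback.fst 𝒜.X.hom (x ≫ ℓ₁) = x ≫ P.left ≫ pullback.fst 𝒜.X.hom ℓ₁)

include hD hΦ in
/-- **THE ISOGENY ROOF, READ AT `(ℓ₁, ℓ₂)`, MOVES TO `(x ≫ ℓ₁, x ≫ ℓ₂)` FOR AN ISOMORPHISM `x`** — see the module docstring.  Input∕output clause texts = the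
E-reading `RoofE` ((r1) `Ker q(Ω) = K`, (r2) `Ker c(Ω) =` the `𝔞`-torsion of `𝒜_{ℓ₂}`, `c` onto, (r3) the two similitude laws with scalar `p`, (r4) `ι`-equivariance
through a common endomorphism of the middle, (r5) `q(σᵃ(ℓ₁)) = c(σᵃ(ℓ₂))`) with the readers of ONE family `(𝒜, ρ, D, pol, lvl)` at the two points spelled in their
★ bodies; `hD` is the Poincaré normalisation of the family; `hK : Φ P ∈ K′ ↔ P ∈ K` threads the kernel subgroup through THE transfer `Φ` (§1).
[cite: MumfordFogartyKirwan1994, Ch. 7 §2 Definition 7.2 (p. 129) and Definition 7.3 (p. 130)] [cite: GortzWedhorn2020, Section (4.7) (pp. 107–108) and Prop. 4.16 (p. 101)]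
[cite: MumfordAV1970, §15 Thm. 1 (p. 143)] [cite: Milne2005ShimuraVarieties, §14 pp. 124–125] -/
theorem roof_readAt_comp (hK : ∀ P, Φ P ∈ K' ↔ P ∈ K)
    (hroof : ∃ (B : AbelianSchemeOver (Spec (.of Ω))) (DB : B.DualPair) (lamB : B.X ⟶ DB.hat.X) (_ : IsMonHom lamB)
        (_ : Nonempty ((Scheme.Modules.pullback DB.unitHatSlice).obj DB.P ≅ SheafOfModules.unit _))
        (q : (𝒜.baseChange ℓ₁).X ⟶ B.X) (_ : IsMonHom q) (c : (𝒜.baseChange ℓ₂).X ⟶ B.X) (_ : IsMonHom c),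
        (∀ P : (𝒜.baseChange ℓ₁).toAffine.toAbelianVariety.Points Ω,
            (AlgPoints.map q P : B.toAffine.toAbelianVariety.Points Ω) = 1 ↔ P ∈ K) ∧
        (∀ P : (𝒜.baseChange ℓ₂).toAffine.toAbelianVariety.Points Ω,
            (AlgPoints.map c P : B.toAffine.toAbelianVariety.Points Ω) = 1 ↔
              ∀ a, 𝔞 a → (AlgPoints.map (baseChangeHom (ρ.i a) ℓ₂) P : (𝒜.baseChange ℓ₂).toAffine.toAbelianVariety.Points Ω) = 1) ∧
        Function.Surjective c.left.base ∧
        q ≫ lamB ≫ DualPair.dualIsogenyOver q (D.baseChange ℓ₁) DB = (pol.baseChange ℓ₁).lam ≫ (D.baseChange ℓ₁).hat.mulN p ∧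
        c ≫ lamB ≫ DualPair.dualIsogenyOver c (D.baseChange ℓ₂) DB = (pol.baseChange ℓ₂).lam ≫ (D.baseChange ℓ₂).hat.mulN p ∧
        (∀ a : O, ∃ b : B.X ⟶ B.X, baseChangeHom (ρ.i a) ℓ₁ ≫ q = q ≫ b ∧ baseChangeHom (ρ.i a) ℓ₂ ≫ c = c ≫ b) ∧
        (∀ a : Fin g ⊕ Fin g → ZMod n,
          (AlgPoints.map q (𝒜.restrictPt ℓ₁ (lvl.section_ a)) : B.toAffine.toAbelianVariety.Points Ω) =
            AlgPoints.map c (𝒜.restrictPt ℓ₂ (lvl.section_ a)))) :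
    ∃ (B : AbelianSchemeOver (Spec (.of Ω'))) (DB : B.DualPair) (lamB : B.X ⟶ DB.hat.X) (_ : IsMonHom lamB)
        (_ : Nonempty ((Scheme.Modules.pullback DB.unitHatSlice).obj DB.P ≅ SheafOfModules.unit _))
        (q : (𝒜.baseChange (x ≫ ℓ₁)).X ⟶ B.X) (_ : IsMonHom q) (c : (𝒜.baseChange (x ≫ ℓ₂)).X ⟶ B.X) (_ : IsMonHom c),
        (∀ P : (𝒜.baseChange (x ≫ ℓ₁)).toAffine.toAbelianVariety.Points Ω',
            (AlgPoints.map q P : B.toAffine.toAbelianVariety.Points Ω') = 1 ↔ P ∈ K') ∧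
        (∀ P : (𝒜.baseChange (x ≫ ℓ₂)).toAffine.toAbelianVariety.Points Ω',
            (AlgPoints.map c P : B.toAffine.toAbelianVariety.Points Ω') = 1 ↔
              ∀ a, 𝔞 a → (AlgPoints.map (baseChangeHom (ρ.i a) (x ≫ ℓ₂)) P :
                (𝒜.baseChange (x ≫ ℓ₂)).toAffine.toAbelianVariety.Points Ω') = 1) ∧
        Function.Surjective c.left.base ∧
        q ≫ lamB ≫ DualPair.dualIsogenyOver q (D.baseChange (x ≫ ℓ₁)) DB =
          (pol.baseChange (x ≫ ℓ₁)).lam ≫ (D.baseChange (x ≫ ℓ₁)).hat.mulN p ∧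
        c ≫ lamB ≫ DualPair.dualIsogenyOver c (D.baseChange (x ≫ ℓ₂)) DB =
          (pol.baseChange (x ≫ ℓ₂)).lam ≫ (D.baseChange (x ≫ ℓ₂)).hat.mulN p ∧
        (∀ a : O, ∃ b : B.X ⟶ B.X, baseChangeHom (ρ.i a) (x ≫ ℓ₁) ≫ q = q ≫ b ∧ baseChangeHom (ρ.i a) (x ≫ ℓ₂) ≫ c = c ≫ b) ∧
        (∀ a : Fin g ⊕ Fin g → ZMod n,
          (AlgPoints.map q (𝒜.restrictPt (x ≫ ℓ₁) (lvl.section_ a)) : B.toAffine.toAbelianVariety.Points Ω') =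
            AlgPoints.map c (𝒜.restrictPt (x ≫ ℓ₂) (lvl.section_ a))) := by
  classical
  -- transfers along `x`
  obtain ⟨ε₁, hε₁⟩ := exists_pointsTransfer x (𝒜.baseChange ℓ₁)
  obtain ⟨ε₂, hε₂⟩ := exists_pointsTransfer x (𝒜.baseChange ℓ₂)
  -- Poincaré pins of all the base-changed dual pairs
  have hD₁ := DualPair.nonempty_unitHatSlice_baseChange_iso (g := x) (D.baseChange ℓ₁) (DualPair.nonempty_unitHatSlice_baseChange_iso (g := ℓ₁) D hD)
  have hD₁' := DualPair.nonempty_unitHatSlice_baseChange_iso (g := x) (D.baseChange ℓ₂) (DualPair.nonempty_unitHatSlice_baseChange_iso (g := ℓ₂) D hD)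
  have hD₂ := DualPair.nonempty_unitHatSlice_baseChange_iso (g := x ≫ ℓ₁) D hD
  have hD₂' := DualPair.nonempty_unitHatSlice_baseChange_iso (g := x ≫ ℓ₂) D hD
  -- the exact comparison isomorphisms `(𝒜 ×_Y ℓᵢ) ×_Ω Spec Ω′ ≅ 𝒜 ×_Y (x ≫ ℓᵢ)`
  obtain ⟨e₁, he₁mon, he₁left, -, he₁lam, he₁σ, he₁act⟩ := exists_iso_of_tupleRel_id ((D.baseChange ℓ₁).baseChange x) (D.baseChange (x ≫ ℓ₁))
    (baseChangeHom (pol.baseChange ℓ₁).lam x) (pol.baseChange (x ≫ ℓ₁)).lam hD₂ ((lvl.baseChange ℓ₁).baseChange x) (lvl.baseChange (x ≫ ℓ₁))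
    (fun a => baseChangeHom (baseChangeHom (ρ.i a) ℓ₁) x) (fun a => baseChangeHom (ρ.i a) (x ≫ ℓ₁))
    (tupleRel_baseChangeCompGrpIso_inv 𝒜 ρ D pol lvl ℓ₁ x)
  obtain ⟨e₂, he₂mon, he₂left, -, he₂lam, he₂σ, he₂act⟩ := exists_iso_of_tupleRel_id ((D.baseChange ℓ₂).baseChange x) (D.baseChange (x ≫ ℓ₂))
    (baseChangeHom (pol.baseChange ℓ₂).lam x) (pol.baseChange (x ≫ ℓ₂)).lam hD₂' ((lvl.baseChange ℓ₂).baseChange x) (lvl.baseChange (x ≫ ℓ₂))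
    (fun a => baseChangeHom (baseChangeHom (ρ.i a) ℓ₂) x) (fun a => baseChangeHom (ρ.i a) (x ≫ ℓ₂))
    (tupleRel_baseChangeCompGrpIso_inv 𝒜 ρ D pol lvl ℓ₂ x)
  haveI := he₁mon
  haveI := he₂mon
  -- the kernel subgroup in the middle stage: pull `K′` back along the points of `e₁`
  obtain ⟨φ₁, hφ₁, -⟩ := exists_mulEquiv_points_of_iso e₁
  have hΦε : ∀ P, Φ P = φ₁ (ε₁ P) := fun P => by
    rw [hφ₁]
    exact pointsAlong_eq_map_pointsTransfer hΦ hε₁ e₁.hom he₁left P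
  -- (1) base change of the roof along `x`
  have hbc := roof_baseChange_of_isIso (e := x) (D.baseChange ℓ₁) (D.baseChange ℓ₂) (pol.baseChange ℓ₁).lam (pol.baseChange ℓ₂).lam
    (fun a => baseChangeHom (ρ.i a) ℓ₁) (fun a => baseChangeHom (ρ.i a) ℓ₂)
    (fun a : Fin g ⊕ Fin g → ZMod n => (𝒜.restrictPt ℓ₁ (lvl.section_ a) : (𝒜.baseChange ℓ₁).toAffine.toAbelianVariety.Points Ω))
    (fun a : Fin g ⊕ Fin g → ZMod n => (𝒜.restrictPt ℓ₂ (lvl.section_ a) : (𝒜.baseChange ℓ₂).toAffine.toAbelianVariety.Points Ω))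
    (fun P => ∀ a, 𝔞 a → (AlgPoints.map (baseChangeHom (ρ.i a) ℓ₂) P : (𝒜.baseChange ℓ₂).toAffine.toAbelianVariety.Points Ω) = 1)
    K p hε₁ hε₂ (fun a => ε₁ (𝒜.restrictPt ℓ₁ (lvl.section_ a))) (fun a => ε₂ (𝒜.restrictPt ℓ₂ (lvl.section_ a)))
    (fun Q => ∀ a, 𝔞 a → (AlgPoints.map (baseChangeHom (baseChangeHom (ρ.i a) ℓ₂) x) Q :
      ((𝒜.baseChange ℓ₂).baseChange x).toAffine.toAbelianVariety.Points Ω') = 1)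
    (K'.comap φ₁.toMonoidHom) (fun _ => rfl) (fun _ => rfl)
    (fun P => pointsTransfer_forall_map_eq_one_iff hε₂ 𝔞 (fun a => baseChangeHom (ρ.i a) ℓ₂) P)
    (fun P => by rw [Subgroup.mem_comap, MulEquiv.coe_toMonoidHom, ← hΦε, hK]) hroof
  -- (3) transport along the exact isomorphisms
  exact roof_transport_along_iso ((D.baseChange ℓ₁).baseChange x) (D.baseChange (x ≫ ℓ₁)) ((D.baseChange ℓ₂).baseChange x) (D.baseChange (x ≫ ℓ₂))
    hD₁ hD₂ hD₁' hD₂' (baseChangeHom (pol.baseChange ℓ₁).lam x) (pol.baseChange (x ≫ ℓ₁)).lam (baseChangeHom (pol.baseChange ℓ₂).lam x) (pol.baseChange (x ≫ ℓ₂)).lam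
    (fun a => baseChangeHom (baseChangeHom (ρ.i a) ℓ₁) x) (fun a => baseChangeHom (ρ.i a) (x ≫ ℓ₁))
    (fun a => baseChangeHom (baseChangeHom (ρ.i a) ℓ₂) x) (fun a => baseChangeHom (ρ.i a) (x ≫ ℓ₂))
    (fun a => ε₁ (𝒜.restrictPt ℓ₁ (lvl.section_ a))) (fun a => 𝒜.restrictPt (x ≫ ℓ₁) (lvl.section_ a))
    (fun a => ε₂ (𝒜.restrictPt ℓ₂ (lvl.section_ a))) (fun a => 𝒜.restrictPt (x ≫ ℓ₂) (lvl.section_ a))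
    (fun Q => ∀ a, 𝔞 a → (AlgPoints.map (baseChangeHom (baseChangeHom (ρ.i a) ℓ₂) x) Q :
      ((𝒜.baseChange ℓ₂).baseChange x).toAffine.toAbelianVariety.Points Ω') = 1)
    (fun Q => ∀ a, 𝔞 a → (AlgPoints.map (baseChangeHom (ρ.i a) (x ≫ ℓ₂)) Q :
      (𝒜.baseChange (x ≫ ℓ₂)).toAffine.toAbelianVariety.Points Ω') = 1)
    (K'.comap φ₁.toMonoidHom) K' e₁ e₂ p he₁lam he₂lam he₁act he₂act
    (fun a => 𝒜.map_pointsTransfer_restrictPt_of_left_eq_baseChangeCompGrpIso_inv ℓ₁ x hε₁ e₁.hom he₁left (lvl.section_ a))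
    (fun a => 𝒜.map_pointsTransfer_restrictPt_of_left_eq_baseChangeCompGrpIso_inv ℓ₂ x hε₂ e₂.hom he₂left (lvl.section_ a))
    (fun Q => forall_map_eq_one_iff_of_iso_inv e₂ 𝔞 (fun a => baseChangeHom (baseChangeHom (ρ.i a) ℓ₂) x)
      (fun a => baseChangeHom (ρ.i a) (x ≫ ℓ₂)) he₂act Q)
    (fun Q => by rw [Subgroup.mem_comap, MulEquiv.coe_toMonoidHom, hφ₁, map_hom_map_inv]) hbc

end ReadAt

/-! ### §3 (ED. 2) Subgroup data along the transfer `Φ` -/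

section AlongSubgroups

variable {Y : Scheme.{u}} {𝒜 : AbelianSchemeOver Y} {Ω Ω' : Type u} [Field Ω] [Field Ω']
  {ℓ : Spec (.of Ω) ⟶ Y} {x : Spec (.of Ω') ⟶ Spec (.of Ω)} [IsIso x]
  (Φ : (𝒜.baseChange ℓ).toAffine.toAbelianVariety.Points Ω ≃* (𝒜.baseChange (x ≫ ℓ)).toAffine.toAbelianVariety.Points Ω')
  (hΦ : ∀ P, (Φ P).left ≫ pullback.fst 𝒜.X.hom (x ≫ ℓ) = x ≫ P.left ≫ pullback.fst 𝒜.X.hom ℓ)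
  {O : Type*} (𝔞 : O → Prop) (act : O → (𝒜.X ⟶ 𝒜.X))

omit [IsIso x] in
/-- **`Φ P ∈ Φ(K) ↔ P ∈ K`** — the kernel-threading input `hK` of ★ `roof_readAt_comp` for `K′ := Φ(K)` (`Φ` injective).
[cite: MumfordFogartyKirwan1994, Ch. 6 §1 Corollary 6.4 (p. 117)] -/
theorem along_mem_map_iff (K : Subgroup ((𝒜.baseChange ℓ).toAffine.toAbelianVariety.Points Ω))
    (P : (𝒜.baseChange ℓ).toAffine.toAbelianVariety.Points Ω) : Φ P ∈ K.map Φ.toMonoidHom ↔ P ∈ K := by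
  rw [← MulEquiv.coe_toMonoidHom, Subgroup.mem_map_iff_mem (fun a b h => Φ.injective h)]

include hΦ

/-- **LINES MOVE ALONG `Φ`**: if `H ≤ 𝒜_ℓ(Ω)` has `n` elements, is `𝔞`-torsion and `ι(a)`-stable for all `a`, then so is `Φ(H) ≤ 𝒜_{x ≫ ℓ}(Ω′)` (count by
injectivity, torsion by ★ `pointsAlong_forall_map_eq_one_iff`, stability by ★ `pointsAlong_map`). [cite: MumfordFogartyKirwan1994, Ch. 6 §1 Corollary 6.4 (p. 117)] -/
theorem along_lines (H : Subgroup ((𝒜.baseChange ℓ).toAffine.toAbelianVariety.Points Ω)) {n : ℕ}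
    (h : Nat.card ↥H = n ∧
      (∀ P ∈ H, ∀ a, 𝔞 a → (AlgPoints.map (baseChangeHom (act a) ℓ) P : (𝒜.baseChange ℓ).toAffine.toAbelianVariety.Points Ω) = 1) ∧
      ∀ a, ∀ P ∈ H, (AlgPoints.map (baseChangeHom (act a) ℓ) P : (𝒜.baseChange ℓ).toAffine.toAbelianVariety.Points Ω) ∈ H) :
    Nat.card ↥(H.map Φ.toMonoidHom) = n ∧
      (∀ P ∈ H.map Φ.toMonoidHom, ∀ a, 𝔞 a →
        (AlgPoints.map (baseChangeHom (act a) (x ≫ ℓ)) P : (𝒜.baseChange (x ≫ ℓ)).toAffine.toAbelianVariety.Points Ω') = 1) ∧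
      ∀ a, ∀ P ∈ H.map Φ.toMonoidHom,
        (AlgPoints.map (baseChangeHom (act a) (x ≫ ℓ)) P : (𝒜.baseChange (x ≫ ℓ)).toAffine.toAbelianVariety.Points Ω') ∈ H.map Φ.toMonoidHom := by
  obtain ⟨hcard, htors, hstab⟩ := h
  refine ⟨(Subgroup.card_map_of_injective (fun a b h => Φ.injective h)).trans hcard, ?_, ?_⟩
  · rintro _ ⟨Q, hQ, rfl⟩
    rw [MulEquiv.coe_toMonoidHom]
    exact (pointsAlong_forall_map_eq_one_iff hΦ 𝔞 act Q).2 (htors Q hQ)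
  · rintro a _ ⟨Q, hQ, rfl⟩
    rw [MulEquiv.coe_toMonoidHom, ← pointsAlong_map hΦ (act a) Q, along_mem_map_iff]
    exact hstab a Q hQ

/-- **THE EXHAUSTION CLAUSE MOVES ALONG `Φ`**: if every `n`-element `𝔞`-torsion `ι`-stable subgroup of `𝒜_ℓ(Ω)` is an `H_β`, then every such subgroup of
`𝒜_{x ≫ ℓ}(Ω′)` is a `Φ(H_β)` (pull back along the bijection `Φ`). [cite: MumfordFogartyKirwan1994, Ch. 6 §1 Corollary 6.4 (p. 117)] -/
theorem along_onto {I : Type*} (Hβ : I → Subgroup ((𝒜.baseChange ℓ).toAffine.toAbelianVariety.Points Ω)) {n : ℕ}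
    (h : ∀ H : Subgroup ((𝒜.baseChange ℓ).toAffine.toAbelianVariety.Points Ω), Nat.card ↥H = n →
      (∀ P ∈ H, ∀ a, 𝔞 a → (AlgPoints.map (baseChangeHom (act a) ℓ) P : (𝒜.baseChange ℓ).toAffine.toAbelianVariety.Points Ω) = 1) →
      (∀ a, ∀ P ∈ H, (AlgPoints.map (baseChangeHom (act a) ℓ) P : (𝒜.baseChange ℓ).toAffine.toAbelianVariety.Points Ω) ∈ H) → ∃ β, Hβ β = H) :
    ∀ H : Subgroup ((𝒜.baseChange (x ≫ ℓ)).toAffine.toAbelianVariety.Points Ω'), Nat.card ↥H = n →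
      (∀ P ∈ H, ∀ a, 𝔞 a →
        (AlgPoints.map (baseChangeHom (act a) (x ≫ ℓ)) P : (𝒜.baseChange (x ≫ ℓ)).toAffine.toAbelianVariety.Points Ω') = 1) →
      (∀ a, ∀ P ∈ H, (AlgPoints.map (baseChangeHom (act a) (x ≫ ℓ)) P : (𝒜.baseChange (x ≫ ℓ)).toAffine.toAbelianVariety.Points Ω') ∈ H) →
      ∃ β, (Hβ β).map Φ.toMonoidHom = H := by
  intro H hcard htors hstab
  have hinj : Function.Injective Φ.toMonoidHom := fun a b h => Φ.injective h
  have hHc : (H.comap Φ.toMonoidHom).map Φ.toMonoidHom = H :=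
    Subgroup.map_comap_eq_self_of_surjective (fun b => Φ.surjective b) H
  have hc : Nat.card ↥(H.comap Φ.toMonoidHom) = n := by
    rw [← Subgroup.card_map_of_injective (K := H.comap Φ.toMonoidHom) hinj, hHc, hcard]
  have ht : ∀ P ∈ H.comap Φ.toMonoidHom, ∀ a, 𝔞 a →
      (AlgPoints.map (baseChangeHom (act a) ℓ) P : (𝒜.baseChange ℓ).toAffine.toAbelianVariety.Points Ω) = 1 := by
    intro P hP
    rw [Subgroup.mem_comap, MulEquiv.coe_toMonoidHom] at hP
    exact (pointsAlong_forall_map_eq_one_iff hΦ 𝔞 act P).1 (htors _ hP)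
  have hs : ∀ a, ∀ P ∈ H.comap Φ.toMonoidHom,
      (AlgPoints.map (baseChangeHom (act a) ℓ) P : (𝒜.baseChange ℓ).toAffine.toAbelianVariety.Points Ω) ∈ H.comap Φ.toMonoidHom := by
    intro a P hP
    rw [Subgroup.mem_comap, MulEquiv.coe_toMonoidHom] at hP ⊢
    rw [pointsAlong_map hΦ (act a) P]
    exact hstab a _ hP
  obtain ⟨β, hβ⟩ := h (H.comap Φ.toMonoidHom) hc ht hs
  exact ⟨β, by rw [hβ, hHc]⟩

/-- **MEMBERSHIP CUT OUT BY A SUBGROUP AND THE `𝔞`-TORSION CONDITION MOVES ALONG `Φ`**: `H = K ∩ 𝒜_ℓ[𝔞](Ω)` gives `Φ(H) = Φ(K) ∩ 𝒜_{x ≫ ℓ}[𝔞](Ω′)`.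
[cite: MumfordFogartyKirwan1994, Ch. 6 §1 Corollary 6.4 (p. 117)] -/
theorem along_mem_iff_mem_and_torsion (H K : Subgroup ((𝒜.baseChange ℓ).toAffine.toAbelianVariety.Points Ω))
    (h : ∀ P, P ∈ H ↔ P ∈ K ∧
      ∀ a, 𝔞 a → (AlgPoints.map (baseChangeHom (act a) ℓ) P : (𝒜.baseChange ℓ).toAffine.toAbelianVariety.Points Ω) = 1) :
    ∀ P, P ∈ H.map Φ.toMonoidHom ↔ P ∈ K.map Φ.toMonoidHom ∧
      ∀ a, 𝔞 a → (AlgPoints.map (baseChangeHom (act a) (x ≫ ℓ)) P : (𝒜.baseChange (x ≫ ℓ)).toAffine.toAbelianVariety.Points Ω') = 1 := by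
  intro P
  obtain ⟨Q, rfl⟩ := Φ.surjective P
  rw [along_mem_map_iff, along_mem_map_iff, pointsAlong_forall_map_eq_one_iff hΦ 𝔞 act Q]
  exact h Q

/-- **MEMBERSHIP CUT OUT BY THE `𝔞`-TORSION CONDITION MOVES ALONG `Φ`**: `K = 𝒜_ℓ[𝔞](Ω)` gives `Φ(K) = 𝒜_{x ≫ ℓ}[𝔞](Ω′)`.
[cite: MumfordFogartyKirwan1994, Ch. 6 §1 Corollary 6.4 (p. 117)] -/
theorem along_mem_iff_torsion (K : Subgroup ((𝒜.baseChange ℓ).toAffine.toAbelianVariety.Points Ω))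
    (h : ∀ P, P ∈ K ↔ ∀ a, 𝔞 a → (AlgPoints.map (baseChangeHom (act a) ℓ) P : (𝒜.baseChange ℓ).toAffine.toAbelianVariety.Points Ω) = 1) :
    ∀ P, P ∈ K.map Φ.toMonoidHom ↔
      ∀ a, 𝔞 a → (AlgPoints.map (baseChangeHom (act a) (x ≫ ℓ)) P : (𝒜.baseChange (x ≫ ℓ)).toAffine.toAbelianVariety.Points Ω') = 1 := by
  intro P
  obtain ⟨Q, rfl⟩ := Φ.surjective P
  rw [along_mem_map_iff, pointsAlong_forall_map_eq_one_iff hΦ 𝔞 act Q]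
  exact h Q

end AlongSubgroups

end AbelianSchemeOver

end Literature.AlgebraicGeometry.AbelianSchemes

end
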